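import Mathlib
import Summits.ResolutionOfSingularities.ResolutionOfSingularities.Theorems.WeightedInvariantLocalWeightedDropNCGameBWinsDefs
import Summits.ResolutionOfSingularities.ResolutionOfSingularities.Theorems.WeightedInvariantLocalWeightedDropNCResRegimeAssembly

/-!
# `WeightedInvariant.LocalWeightedDrop` ENGINE, W′|₄ line — D₃ᴮ object (2a): THE NC-RESOLUTION PHASE ASSEMBLY IN B-PERMISSIBLE FORM

Sub-problem `ResolutionOfSingularities`, ENGINE crux `stmt-ResolutionOfSingularities-8899` (`LocalWeightedDrop`), registered stub W′|₄
`stub_wildWideApexFourStartsWon`; res-L1-w43-plan-1 RULING 2026-08-27T21:45:42Z (D₃ᴮ lane (b)(2): re-thread the m = 2 assemblies to `DBWinsTo`);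
res-L1-w43-strat-1 STRATEGY-CENSUS §14.7 / `g11/snc2_interface_v1.lean` (D₃ᴮ `stub_surfaceBoundaryNC₃`).  [OURS · L1 W4.3 · chain w43 · res-L1-w43-lead-1 g6;
def-free; the proofs of …NCResPhaseAssembly (res-L1-w43-stub-1) and …NCResRegimeAssembly (lead-1 g5) VERBATIM with `DBWinsTo` (…NCGameBWinsDefs, p575221) in place of
`DWinsTo`; nothing here is a statement of any manuscript; AI-produced, gate-checked, weaker than expert review.]

The outer structure of the positional embedded NC-resolution of surface germs (m + 1 = 3 variables), now with B-PERMISSIBLE moves and TRANSFORM successors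
throughout — the form the x₀-lift of the W′|₄ line consumes:
* `dbWinsTo_germIsNC_of_headPhase` — well-founded induction on the head `(o, c)`;
* `headPhaseB_of_high_of_end` — the head phase from the `o ≥ 2` phase and the `o ≤ 1` endgame;
* `highPhaseB_of_step` — the inner induction of the `o ≥ 2` phase on a secondary well-founded measure;
* `highPhaseB_of_regimes` — the `o ≥ 2` phase from the four regimes (H) apex column / (P) presented / (L) letter directrix / (B) bad position, each in
  `DBWinsTo` form (regime rank as in `highPhase_of_regimes`);
* **`surfaceBoundaryNC_of_regimesB`** — D₃ᴮ (`∀ admissible (b, δ)`, in particular `δ.O = ∅`: `DBWinsTo GermIsNC`) from the four B-regimes and the B-endgame —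
  the TYPED INTERFACE whose five hypotheses are the re-thread targets for hands.
-/

set_option linter.dupNamespace false -- mandated namespace of this single-conjunct summit

noncomputable section

namespace Summit.ResolutionOfSingularities.ResolutionOfSingularities.Theorems

namespace TameFourTupleDrop

open MvPowerSeries Literature.AlgebraicGeometry.Resolution

variable {k : Type} [Field k] {m : ℕ}

/-! ## The outer induction on the head -/

/-- **THE OUTER INDUCTION, B-form.**  If from every admissibly decorated position the mover B-forces «normal crossing, or admissible of strictly smaller
head», then from every admissibly decorated position the mover B-forces a normal crossing. -/
theorem dbWinsTo_germIsNC_of_headPhase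
    (hphase : ∀ (b : MvPowerSeries (Fin (m + 1)) k) (δ : Decoration k m), Admissible b δ →
      DBWinsTo (fun τ => GermIsNC τ.1 ∨ (Admissible τ.1 τ.2 ∧ τ.2.head < δ.head)) (b, δ))
    {b : MvPowerSeries (Fin (m + 1)) k} {δ : Decoration k m} (hadm : Admissible b δ) :
    DBWinsTo (fun τ : MvPowerSeries (Fin (m + 1)) k × Decoration k m => GermIsNC τ.1) (b, δ) := by
  suffices H : ∀ (h : ℕ ×ₗ ℕ) (b : MvPowerSeries (Fin (m + 1)) k) (δ : Decoration k m), δ.head = h → Admissible b δ →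
      DBWinsTo (fun τ : MvPowerSeries (Fin (m + 1)) k × Decoration k m => GermIsNC τ.1) (b, δ) from
    H _ b δ rfl hadm
  intro h
  induction h using WellFoundedLT.induction with
  | ind h ih =>
    intro b δ hh hadm
    subst hh
    exact (hphase b δ hadm).bind fun τ hτ => hτ.elim (fun hnc => DBWinsTo.of_target hnc)
      fun hτ' => ih τ.2.head hτ'.2 τ.1 τ.2 rfl hτ'.1

/-- **THE HEAD PHASE FROM ITS TWO HALVES, B-form.** -/
theorem headPhaseB_of_high_of_end
    (hhigh : ∀ (b : MvPowerSeries (Fin (m + 1)) k) (δ : Decoration k m), Admissible b δ → 2 ≤ δ.o →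
      DBWinsTo (fun τ => Admissible τ.1 τ.2 ∧ τ.2.head < δ.head) (b, δ))
    (hend : ∀ (b : MvPowerSeries (Fin (m + 1)) k) (δ : Decoration k m), Admissible b δ → δ.o ≤ 1 →
      DBWinsTo (fun τ => GermIsNC τ.1 ∨ (Admissible τ.1 τ.2 ∧ τ.2.head < δ.head)) (b, δ))
    (b : MvPowerSeries (Fin (m + 1)) k) (δ : Decoration k m) (hadm : Admissible b δ) :
    DBWinsTo (fun τ => GermIsNC τ.1 ∨ (Admissible τ.1 τ.2 ∧ τ.2.head < δ.head)) (b, δ) := by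
  rcases Nat.lt_or_ge δ.o 2 with h2 | h2
  · exact hend b δ hadm (Nat.lt_succ_iff.mp h2)
  · exact (hhigh b δ hadm h2).mono fun τ hτ => Or.inr hτ

/-- **THE INNER INDUCTION OF THE `o ≥ 2` PHASE, B-form** (secondary measure `ν` in any well-founded order). -/
theorem highPhaseB_of_step {α : Type} [LT α] [WellFoundedLT α] (ν : MvPowerSeries (Fin (m + 1)) k × Decoration k m → α)
    (hstep : ∀ (b : MvPowerSeries (Fin (m + 1)) k) (δ : Decoration k m), Admissible b δ → 2 ≤ δ.o →
      DBWinsTo (fun τ => Admissible τ.1 τ.2 ∧ (τ.2.head < δ.head ∨ (τ.2.head = δ.head ∧ ν τ < ν (b, δ)))) (b, δ))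
    (b : MvPowerSeries (Fin (m + 1)) k) (δ : Decoration k m) (hadm : Admissible b δ) (ho : 2 ≤ δ.o) :
    DBWinsTo (fun τ => Admissible τ.1 τ.2 ∧ τ.2.head < δ.head) (b, δ) := by
  suffices H : ∀ (a : α) (b' : MvPowerSeries (Fin (m + 1)) k) (δ' : Decoration k m), ν (b', δ') = a → Admissible b' δ' →
      δ'.head = δ.head → DBWinsTo (fun τ => Admissible τ.1 τ.2 ∧ τ.2.head < δ.head) (b', δ') from H _ b δ rfl hadm rfl
  intro a
  induction a using WellFoundedLT.induction with
  | ind a ih =>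
    intro b' δ' ha hadm' hh
    subst ha
    have ho' : 2 ≤ δ'.o := by
      have hh' := hh
      rw [Decoration.head, Decoration.head, toLex_inj] at hh'
      have hoo : δ'.o = δ.o := (Prod.ext_iff.mp hh').1
      rw [hoo]
      exact ho
    refine (hstep b' δ' hadm' ho').bind fun τ hτ => ?_
    rcases hτ with ⟨hadmτ, hlt | ⟨heq, hν⟩⟩
    · exact DBWinsTo.of_target ⟨hadmτ, hh ▸ hlt⟩
    · exact ih (ν τ) hν τ.1 τ.2 rfl hadmτ (heq.trans hh)

/-! ## The `o ≥ 2` phase from the four regimes -/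

/-- **THE `o ≥ 2` HEAD PHASE FROM THE FOUR REGIME THEOREMS, B-form** (three letters, any field with infinitely many elements; regime rank: apex column 0,
presented 1, bad position 2, letter directrix 3 — the proof of `highPhase_of_regimes` verbatim). -/
theorem highPhaseB_of_regimes [Infinite k]
    (hH : ∀ (b : MvPowerSeries (Fin (2 + 1)) k) (δ : Decoration k 2), Admissible b δ → 2 ≤ δ.o → δ.HCol →
      DBWinsTo (fun τ => Admissible τ.1 τ.2 ∧ τ.2.head < δ.head) (b, δ))
    (hP : ∀ (b : MvPowerSeries (Fin (2 + 1)) k) (δ : Decoration k 2), Admissible b δ → 2 ≤ δ.o → ¬ δ.HCol →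
      (δ.O.Nonempty ∨ δ.GoodDir) →
      DBWinsTo (fun τ => Admissible τ.1 τ.2 ∧ (τ.2.head < δ.head ∨ (τ.2.head = δ.head ∧ τ.2.HCol))) (b, δ))
    (hL : ∀ (b : MvPowerSeries (Fin (2 + 1)) k) (δ : Decoration k 2) (l : Fin (2 + 1)), Admissible b δ → 2 ≤ δ.o → ¬ δ.HCol →
      δ.LetterDir l →
      DBWinsTo (fun τ => Admissible τ.1 τ.2 ∧ (τ.2.head < δ.head ∨ (τ.2.head = δ.head ∧ (τ.2.HCol ∨ τ.2.GoodDir ∨ τ.2.BadDir)))) (b, δ))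
    (hB : ∀ (b : MvPowerSeries (Fin (2 + 1)) k) (δ : Decoration k 2), Admissible b δ → 2 ≤ δ.o → ¬ δ.HCol → δ.BadDir →
      DBWinsTo (fun τ => Admissible τ.1 τ.2 ∧ (τ.2.head < δ.head ∨ (τ.2.head = δ.head ∧ (τ.2.HCol ∨ τ.2.GoodDir)))) (b, δ))
    (b : MvPowerSeries (Fin (2 + 1)) k) (δ : Decoration k 2) (hadm : Admissible b δ) (ho : 2 ≤ δ.o) :
    DBWinsTo (fun τ => Admissible τ.1 τ.2 ∧ τ.2.head < δ.head) (b, δ) := by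
  classical
  let rk : Decoration k 2 → ℕ := fun ε =>
    if ε.HCol then 0 else if ε.O.Nonempty ∨ ε.GoodDir then 1 else if ε.BadDir then 2 else 3
  have rk_hcol : ∀ ε : Decoration k 2, ε.HCol → rk ε = 0 := fun ε h => by
    simp only [rk, if_pos h]
  have rk_good : ∀ ε : Decoration k 2, ε.GoodDir → rk ε ≤ 1 := fun ε h => by
    simp only [rk]
    split_ifs <;> simp_all
  have rk_bad : ∀ ε : Decoration k 2, ε.BadDir → rk ε ≤ 2 := fun ε h => by
    simp only [rk]
    split_ifs <;> simp_all
  refine highPhaseB_of_step (α := ℕ) (fun τ => rk τ.2) (fun b' δ' hadm' ho' => ?_) b δ hadm ho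
  by_cases hc : δ'.HCol
  · exact (hH b' δ' hadm' ho' hc).mono fun τ hτ => ⟨hτ.1, Or.inl hτ.2⟩
  by_cases hp : δ'.O.Nonempty ∨ δ'.GoodDir
  · have hrk : rk δ' = 1 := by simp only [rk, if_neg hc, if_pos hp]
    refine (hP b' δ' hadm' ho' hc hp).mono fun τ hτ => ⟨hτ.1, hτ.2.imp_right fun h => ⟨h.1, ?_⟩⟩
    change rk τ.2 < rk δ'
    rw [hrk, rk_hcol τ.2 h.2]
    exact zero_lt_one
  by_cases hb : δ'.BadDir
  · have hrk : rk δ' = 2 := by simp only [rk, if_neg hc, if_neg hp, if_pos hb]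
    refine (hB b' δ' hadm' ho' hc hb).mono fun τ hτ => ⟨hτ.1, hτ.2.imp_right fun h => ⟨h.1, ?_⟩⟩
    change rk τ.2 < rk δ'
    rw [hrk]
    rcases h.2 with h0 | h1
    · rw [rk_hcol τ.2 h0]; exact zero_lt_two
    · exact lt_of_le_of_lt (rk_good τ.2 h1) one_lt_two
  · have hrk : rk δ' = 3 := by simp only [rk, if_neg hc, if_neg hp, if_neg hb]
    obtain ⟨l, hl⟩ : ∃ l, δ'.LetterDir l := by
      rcases Decoration.regime_split hadm' ho' hc with h | h | h | h
      · exact absurd (Or.inl h) hp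
      · exact absurd (Or.inr h) hp
      · exact absurd h hb
      · exact h
    refine (hL b' δ' l hadm' ho' hc hl).mono fun τ hτ => ⟨hτ.1, hτ.2.imp_right fun h => ⟨h.1, ?_⟩⟩
    change rk τ.2 < rk δ'
    rw [hrk]
    rcases h.2 with h0 | h1 | h2
    · rw [rk_hcol τ.2 h0]; exact zero_lt_three
    · exact lt_of_le_of_lt (rk_good τ.2 h1) (by norm_num)
    · exact lt_of_le_of_lt (rk_bad τ.2 h2) (by norm_num)

/-! ## D₃ᴮ from the four B-regimes and the B-endgame -/

/-- **D₃ᴮ — POSITIONAL EMBEDDED NC-RESOLUTION OF SURFACE GERMS BY B-PERMISSIBLE MOVES WITH TRANSFORM SUCCESSORS, FROM ITS FIVE PIECES.**  Over an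
algebraically closed field of characteristic `p`: if the four head regimes (H) (P) (L) (B) and the `o ≤ 1` endgame hold in `DBWinsTo` form, then from EVERY
admissibly decorated position of the three-letter NC game the mover B-forces a normal crossing — in particular res-L1-w43-strat-1's
`stub_surfaceBoundaryNC₃` (the `δ.O = ∅` case consumed by the x₀-lift of the W′|₄ line). -/
theorem surfaceBoundaryNC_of_regimesB (p : ℕ) [Fact p.Prime] [CharP k p] [IsAlgClosed k]
    (hH : ∀ (b : MvPowerSeries (Fin (2 + 1)) k) (δ : Decoration k 2), Admissible b δ → 2 ≤ δ.o → δ.HCol →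
      DBWinsTo (fun τ => Admissible τ.1 τ.2 ∧ τ.2.head < δ.head) (b, δ))
    (hP : ∀ (b : MvPowerSeries (Fin (2 + 1)) k) (δ : Decoration k 2), Admissible b δ → 2 ≤ δ.o → ¬ δ.HCol →
      (δ.O.Nonempty ∨ δ.GoodDir) →
      DBWinsTo (fun τ => Admissible τ.1 τ.2 ∧ (τ.2.head < δ.head ∨ (τ.2.head = δ.head ∧ τ.2.HCol))) (b, δ))
    (hL : ∀ (b : MvPowerSeries (Fin (2 + 1)) k) (δ : Decoration k 2) (l : Fin (2 + 1)), Admissible b δ → 2 ≤ δ.o → ¬ δ.HCol →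
      δ.LetterDir l →
      DBWinsTo (fun τ => Admissible τ.1 τ.2 ∧ (τ.2.head < δ.head ∨ (τ.2.head = δ.head ∧ (τ.2.HCol ∨ τ.2.GoodDir ∨ τ.2.BadDir)))) (b, δ))
    (hB : ∀ (b : MvPowerSeries (Fin (2 + 1)) k) (δ : Decoration k 2), Admissible b δ → 2 ≤ δ.o → ¬ δ.HCol → δ.BadDir →
      DBWinsTo (fun τ => Admissible τ.1 τ.2 ∧ (τ.2.head < δ.head ∨ (τ.2.head = δ.head ∧ (τ.2.HCol ∨ τ.2.GoodDir)))) (b, δ))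
    (hend : ∀ (b : MvPowerSeries (Fin (2 + 1)) k) (δ : Decoration k 2), Admissible b δ → δ.o ≤ 1 →
      DBWinsTo (fun τ => GermIsNC τ.1 ∨ (Admissible τ.1 τ.2 ∧ τ.2.head < δ.head)) (b, δ))
    (b : MvPowerSeries (Fin (2 + 1)) k) (δ : Decoration k 2) (hadm : Admissible b δ) :
    DBWinsTo (fun τ : MvPowerSeries (Fin (2 + 1)) k × Decoration k 2 => GermIsNC τ.1) (b, δ) := by
  haveI : Infinite k := IsAlgClosed.instInfinite
  exact dbWinsTo_germIsNC_of_headPhase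
    (headPhaseB_of_high_of_end (highPhaseB_of_regimes hH hP hL hB) hend) hadm

end TameFourTupleDrop

end Summit.ResolutionOfSingularities.ResolutionOfSingularities.Theorems

end
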